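/- Width seat `ym-line-cbag-p1-w3` (prover-ym-line-cbag-p1-w3-g6-0), route `ColdBoxAllGroups`, crux `BoxFloorAllGroups`
(stmt-QuantumFields-22254, CLOSED proved): the one-scale expansion of the cold box for an ARBITRARY PAIR OF PLAQUETTES — bricks B2 and
B9a of stub S2 re-assembled for general plaquettes `p, q` touching the box (the landed bricks are already plane-generic). -/
import Summits.QuantumFields.YangMills.Theorems.ColdBoxAllGroupsBoxFloorAllGroupsCoreG
import Summits.QuantumFields.YangMills.Theorems.ColdBoxAllGroupsBoxFloorAllGroupsGoodReductionG

/-!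
# Route `ColdBoxAllGroups`, BOX half for ALL PLAQUETTE PAIRS — part 1/2: the large-field conditioning (B2) and the deterministic core (B9a)
# of the one-scale expansion, for two arbitrary plaquettes of the cold box

The proved crux `BoxFloorAllGroups` (stmt-QuantumFields-22254, `BoxFloorAllGroups_proof`) and its load-bearing stub S2
`stub_boxDirichletDominationAbsG` concern ONE pair of plaquettes: the `(1,2)`-plaquette at the centre of the cold-wall box `[0,2H]⁴` and its
translate by `T e₀` (`boxPlaqCov`).  The bricks of the line, however, are plane- and position-generic: the representation of the conditioned
box state as a tilted conditioned Gaussian (`hrep`, B4', any gauge-invariant observable), the cubic tilt bound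
`abs_qObsD_sub_beta_mul_plaqCostAt_le` (B7, any `(x; i, j)`), the small-field bound `beta_mul_plaqCostAt_mem_Icc_of_mem_goodTE` (B8', any
plaquette touching the box), the Dirichlet variances `integral_dirCirc_sq_le_one_of_touching` and the colour identity
`cov_qObsD_gaussD_eq_general` (B8, any two plaquettes), the covariance bookkeeping `abs_cov_tilted_cond_sub_cov_le` (generic).  This file
re-assembles them for two ARBITRARY plaquettes `p, q ∈ plaquettesTouching (boxEdges 4 (2H+1))`, with costs
`c_p = plaqCostAt ρ p.1 p.2.1.1 p.2.1.2` (`= N − Re tr ρ(U_p)`):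
* `integrable_plaqCostAt_mul_of_rep'` — integrability of `c_p · c_q` for plaquettes in different planes;
* **`abs_boxPairCov_sub_cond_le_of_rep`** (B2, all pairs) — for `0 < θ`, `ε > 2θ`, eventually in `β`, for ALL sites `x, y` and planes
  `(i,j)`, `(k,l)`: the covariance of `c_{(x;i,j)}`, `c_{(y;k,l)}` under `boxState ρ β ⌈β^θ⌉` differs from the one under the box state
  conditioned on `coldGoodSetG ρ ⌈β^θ⌉ β ε` by at most `24N²·e^{−β^ε}`;
* **`abs_boxPairCov_sub_dirCircSqCov_le_coreG`** (B9a, all pairs) — at fixed `β`, under the hypotheses of the lead's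
  `abs_boxPlaqCov_sub_dirCircSqCov_le_coreG` with `T ≤ H` replaced by `p, q ∈ plaquettesTouching (boxEdges 4 (2H+1))`:
  `|β²·Cov_box(c_p, c_q) − (D/4)·(E_D[s_p² s_q²] − E_D[s_p²] E_D[s_q²])| ≤ β²c₀ + 3M²(e^{2w}−1) + 6M²p + 2τ(M+D) + √p(2MD + 3D² + D²)`,
  `s_p = dirCirc H p` the Dirichlet-Gaussian plaquette circulation, `D = dimE ρ`, `M = β^{2ε}`, `τ = 190βm³`, `w = #Λ'·τ + #(ColdFreeIdx H)·ℓ`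
  — the proof is the lead's B9a verbatim with the centre pair replaced by `(p, q)`;
* bookkeeping for part 2: `cov_sum_sum_eq` (bilinearity of the covariance over finite sums), `mem_plaquettesTouching_of_coords` /
  `centre_pair_mem_plaquettesTouching` (plaquettes based in `[0, 2H−1]⁴` touch the box; the six plaquettes at the centre and at its translate by
  `T e₀`, `T + 1 ≤ H`), `sum_sum_ge_single_sub` / `sq_mul_cov_planeSum_ge` (if all 36 plane-pair covariances at two
  sites are `≥ −e`, the covariance of the two six-plane cost sums is `≥` the `(1,2)/(1,2)` one minus `35e`).
Part 2 (`ColdBoxAllGroupsBoxAllPairsExpansion`) does the eventual assembly (B9b/B9c: `≤ β^{−9θ}` for `θ ≤ 1/100`) and the consequences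
(Wick nonnegativity of all pair covariances; the cold-box floor for the six-plane corner action density).
No sorry; no new definition; standard axioms.  NOT a claim about the Yang–Mills mass gap: rung-level support (RECORD label R2xi-G), BOX side
of the planner's follow-up «all plaquette planes» (INVENTORY §5.3 of the crux); no summit statement is touched.
-/

set_option autoImplicit false

noncomputable section

open MeasureTheory ProbabilityTheory Finset Real
open Literature.Probability.LatticeModels (Site)
open Literature.MathematicalPhysics.QuantumLattice
open Literature.MathematicalPhysics.QuantumFieldTheory
open Literature.MathematicalPhysics.QuantumFieldTheory.LatticeMaxwell
open Literature.MathematicalPhysics.QuantumFieldTheory.AxialGauge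
open Summit.QuantumFields.YangMills.Theorems.WeakCouplingRates
open Summit.QuantumFields.YangMills.Theorems.FreeEnergyLogCoefficient

namespace Summit.QuantumFields.YangMills.Theorems.ColdBoxAllGroups

/-! ## Bookkeeping: covariance of finite sums; plaquettes based in `[0, 2H−1]⁴` touch the box -/

/-- Bilinearity of the covariance over finite sums: `Cov(Σ_a f_a, Σ_b g_b) = Σ_a Σ_b Cov(f_a, g_b)`. -/
theorem cov_sum_sum_eq {Ω ι : Type*} [MeasurableSpace Ω] [Fintype ι] (μ : Measure Ω) (f g : ι → Ω → ℝ)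
    (hf : ∀ a, Integrable (f a) μ) (hg : ∀ b, Integrable (g b) μ) (hfg : ∀ a b, Integrable (fun ω => f a ω * g b ω) μ) :
    (∫ ω, (∑ a, f a ω) * (∑ b, g b ω) ∂μ) - (∫ ω, ∑ a, f a ω ∂μ) * (∫ ω, ∑ b, g b ω ∂μ) =
      ∑ a, ∑ b, ((∫ ω, f a ω * g b ω ∂μ) - (∫ ω, f a ω ∂μ) * (∫ ω, g b ω ∂μ)) := by
  have e1 : ∫ ω, (∑ a, f a ω) * (∑ b, g b ω) ∂μ = ∑ a, ∑ b, ∫ ω, f a ω * g b ω ∂μ := by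
    have : (fun ω => (∑ a, f a ω) * (∑ b, g b ω)) = fun ω => ∑ a, ∑ b, f a ω * g b ω := by
      funext ω; rw [Finset.sum_mul_sum]
    rw [this, integral_finsetSum _ fun a _ => integrable_finsetSum _ fun b _ => hfg a b]
    exact Finset.sum_congr rfl fun a _ => integral_finsetSum _ fun b _ => hfg a b
  have e2 : ∫ ω, ∑ a, f a ω ∂μ = ∑ a, ∫ ω, f a ω ∂μ := integral_finsetSum _ fun a _ => hf a
  have e3 : ∫ ω, ∑ b, g b ω ∂μ = ∑ b, ∫ ω, g b ω ∂μ := integral_finsetSum _ fun b _ => hg b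
  rw [e1, e2, e3, Finset.sum_mul_sum]
  simp only [← Finset.sum_sub_distrib]

/-- A plaquette based at a site of `[0, 2H−1]⁴` (in any plane) touches the cold box: its edge `(x, i)` lies in `boxEdges 4 (2H+1)`. -/
theorem mem_plaquettesTouching_of_coords {H : ℕ} (x : Site 4) (q : {q : Fin 4 × Fin 4 // q.1 < q.2})
    (hx : ∀ k, 0 ≤ x k ∧ x k + 1 ≤ 2 * (H : ℤ)) :
    ((x, q) : ZdPlaquette 4) ∈ plaquettesTouching (boxEdges 4 (2 * H + 1)) := by
  rw [mem_plaquettesTouching_iff]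
  refine ⟨(x, q.1.1), Finset.mem_inter.2 ⟨by simp [plaquetteEdges], ?_⟩⟩
  rw [mem_boxEdges_iff]
  refine ⟨fun k => ⟨(hx k).1, by have := (hx k).2; push_cast; omega⟩, by have := (hx q.1.1).2; push_cast; omega⟩

/-- The six plaquettes at the centre of the box and the six at its translate by `T e₀`, `T + 1 ≤ H`, touch the box. -/
theorem centre_pair_mem_plaquettesTouching {H T : ℕ} (hH : 1 ≤ H) (hT : T + 1 ≤ H) (q q' : {q : Fin 4 × Fin 4 // q.1 < q.2}) :
    ((boxCentre H, q) : ZdPlaquette 4) ∈ plaquettesTouching (boxEdges 4 (2 * H + 1)) ∧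
      ((boxCentre H + Pi.single 0 (T : ℤ), q') : ZdPlaquette 4) ∈ plaquettesTouching (boxEdges 4 (2 * H + 1)) := by
  have hH' : (1 : ℤ) ≤ H := by exact_mod_cast hH
  have hT' : (T : ℤ) + 1 ≤ H := by exact_mod_cast hT
  constructor
  · refine mem_plaquettesTouching_of_coords _ q fun k => ?_
    simp only [boxCentre]; constructor <;> omega
  · refine mem_plaquettesTouching_of_coords _ q' fun k => ?_
    by_cases hk : k = 0
    · subst hk; simp only [Pi.add_apply, boxCentre, Pi.single_eq_same]; constructor <;> omega
    · simp only [Pi.add_apply, boxCentre, Pi.single_eq_of_ne hk, add_zero]; constructor <;> omega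


variable {N : ℕ} {G : Type*} [Group G] [TopologicalSpace G] [IsTopologicalGroup G] [CompactSpace G]
  [MeasurableSpace G] [BorelSpace G] [SecondCountableTopology G]
variable (ρ : G →* Matrix (Fin N) (Fin N) ℂ) {H : ℕ}

omit [CompactSpace G] in
/-- The product of two plaquette costs (any two sites, any two planes) is integrable under any finite measure. -/
theorem integrable_plaqCostAt_mul_of_rep' (hρc : Continuous ρ) (hρu : ∀ g, ρ g ∈ Matrix.unitaryGroup (Fin N) ℂ)
    (x y : Site 4) (i j k l : Fin 4) (μ : Measure (LGConfig 4 G)) [IsFiniteMeasure μ] :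
    Integrable (fun U => plaqCostAt ρ x i j U * plaqCostAt ρ y k l U) μ :=
  integrable_of_bound ((measurable_plaqCostAt_of_continuous ρ hρc x i j).mul
    (measurable_plaqCostAt_of_continuous ρ hρc y k l)).aestronglyMeasurable (C := 2 * N * (2 * N))
    (fun U => by
      rw [abs_mul]
      exact mul_le_mul (abs_plaqCostAt_leG ρ hρu x i j U) (abs_plaqCostAt_leG ρ hρu y k l U) (abs_nonneg _)
        (by positivity))

/-- **Brick B2 for all plaquette pairs: conditioning the cold box on small fields costs `24N²·e^{−β^ε}` on EVERY two-plaquette covariance.**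
For `0 < θ`, `ε > 2θ`, eventually in `β`, for all sites `x, y` and planes `(i,j)`, `(k,l)`, the covariance of the plaquette costs
`c_{(x;i,j)}`, `c_{(y;k,l)}` under `boxState ρ β ⌈β^θ⌉` differs from the same covariance under the box state CONDITIONED on
`coldGoodSetG ρ ⌈β^θ⌉ β ε` by at most `24N²·exp(−β^ε)` (`abs_cov_sub_cov_cond_le` with `|cost| ≤ 2N`, and B1). -/
theorem abs_boxPairCov_sub_cond_le_of_rep (hρc : Continuous ρ) (hρu : ∀ g, ρ g ∈ Matrix.unitaryGroup (Fin N) ℂ)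
    {θ ε : ℝ} (hθ : 0 < θ) (hε : 2 * θ < ε) :
    ∃ β₀ : ℝ, ∀ β : ℝ, β₀ ≤ β → ∀ (x y : Site 4) (i j k l : Fin 4),
      |((∫ U, plaqCostAt ρ x i j U * plaqCostAt ρ y k l U ∂(boxState ρ β ⌈β ^ θ⌉₊)) -
          (∫ U, plaqCostAt ρ x i j U ∂(boxState ρ β ⌈β ^ θ⌉₊)) * (∫ U, plaqCostAt ρ y k l U ∂(boxState ρ β ⌈β ^ θ⌉₊))) -
        ((∫ U, plaqCostAt ρ x i j U * plaqCostAt ρ y k l U ∂((boxState ρ β ⌈β ^ θ⌉₊)[|coldGoodSetG ρ ⌈β ^ θ⌉₊ β ε])) -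
          (∫ U, plaqCostAt ρ x i j U ∂((boxState ρ β ⌈β ^ θ⌉₊)[|coldGoodSetG ρ ⌈β ^ θ⌉₊ β ε])) *
          (∫ U, plaqCostAt ρ y k l U ∂((boxState ρ β ⌈β ^ θ⌉₊)[|coldGoodSetG ρ ⌈β ^ θ⌉₊ β ε])))| ≤
        24 * (N : ℝ) ^ 2 * Real.exp (-(β ^ ε)) := by
  obtain ⟨β₀, hβ₀⟩ := boxState_real_compl_coldGoodSetG_le ρ hρc hρu hθ hε
  obtain ⟨β₁, hβ₁⟩ := boxState_coldGoodSetG_ne_zero ρ hρc hρu hθ hε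
  refine ⟨max β₀ β₁, fun β hβ x y i j k l => ?_⟩
  have hb0 : β₀ ≤ β := (le_max_left _ _).trans hβ
  have hb1 : β₁ ≤ β := (le_max_right _ _).trans hβ
  set Hh := ⌈β ^ θ⌉₊ with hH
  set μ := boxState ρ β Hh with hμ
  haveI : IsProbabilityMeasure μ := by
    rw [hμ]; exact isProbabilityMeasure_ymSpecification _ hρc β _ _
  set Gd := coldGoodSetG ρ Hh β ε with hG
  have hGm : MeasurableSet Gd := measurableSet_coldGoodSetG ρ hρc β ε
  have hbad : μ.real Gdᶜ ≤ Real.exp (-(β ^ ε)) := hβ₀ β hb0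
  have hG0 : μ Gd ≠ 0 := hβ₁ β hb1
  have key := abs_cov_sub_cov_cond_le (μ := μ) hGm hG0 (integrable_plaqCostAt_of_rep ρ hρc hρu x i j μ)
    (integrable_plaqCostAt_of_rep ρ hρc hρu y k l μ) (integrable_plaqCostAt_mul_of_rep' ρ hρc hρu x y i j k l μ)
    (abs_plaqCostAt_leG ρ hρu x i j) (abs_plaqCostAt_leG ρ hρu y k l)
  calc _ ≤ 6 * (2 * (N : ℝ)) * (2 * N) * μ.real Gdᶜ := key
    _ ≤ 24 * (N : ℝ) ^ 2 * Real.exp (-(β ^ ε)) := by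
        have h0 : (0 : ℝ) ≤ μ.real Gdᶜ := measureReal_nonneg
        nlinarith [hbad, sq_nonneg (N : ℝ)]

set_option maxHeartbeats 400000 in
/-- **The one-scale expansion at fixed `β` (deterministic core) for an ARBITRARY PAIR of plaquettes touching the box, every compact group
presented in `U(N)`.**  Hypotheses as in `abs_boxPlaqCov_sub_dirCircSqCov_le_coreG` (β ≥ 1, H ≥ 1, link radius `m ≤ 1/4`, chart density `g`
with `|log g| ≤ ℓ` on `b(0,m)`, Gaussian window, `p < 1`, the representation `hrep` (B4') and the conditioning `hcond` (B2) for the pair);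
the conclusion is
`|β²·Cov_{boxState}(c_p, c_q) − (D/4)·(E_D[s_p²s_q²] − E_D[s_p²]E_D[s_q²])| ≤ β²c₀ + 3M²(e^{2w}−1) + 6M²p + 2τ(M+D) + √p(2MD + 3D² + D²)`. -/
theorem abs_boxPairCov_sub_dirCircSqCov_le_coreG (hρ : Continuous ρ) (hinj : Function.Injective ρ)
    (hρu : ∀ g, ρ g ∈ Matrix.unitaryGroup (Fin N) ℂ) {β ε m ℓ R p c₀ : ℝ}
    {P Q : ZdPlaquette 4} (hP : P ∈ plaquettesTouching (boxEdges 4 (2 * H + 1))) (hQ : Q ∈ plaquettesTouching (boxEdges 4 (2 * H + 1)))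
    {g : EuclideanSpace ℝ (Fin (dimE ρ)) → ℝ} (hgm : Measurable g)
    (hβ : 1 ≤ β) (hH : 1 ≤ H) (hm0 : 0 ≤ m) (hm4 : m ≤ 1 / 4) (hℓ : 0 ≤ ℓ)
    (hg : ∀ a, ‖a‖ ≤ m → |Real.log (g a)| ≤ ℓ) (hR : 0 ≤ R)
    (hmE : Real.sqrt (dimE ρ) * ((12 * (H : ℝ) ^ 2 + 2 * H + 1) * R) / Real.sqrt β ≤ 1 / 4)
    (hmEm : Real.sqrt (dimE ρ) * ((12 * (H : ℝ) ^ 2 + 2 * H + 1) * R) / Real.sqrt β ≤ m)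
    (hwin : (dimE ρ : ℝ) / 2 * R ^ 2 / β + 190 * (Real.sqrt (dimE ρ) * ((12 * (H : ℝ) ^ 2 + 2 * H + 1) * R) / Real.sqrt β) ^ 3 <
      β ^ (2 * ε - 1))
    (hp : 240 * (dimE ρ) * (2 * (H : ℝ) + 1) ^ 4 * Real.exp (-R ^ 2 / 2) ≤ p) (hp1 : p < 1)
    (hrep : ∀ X : LGConfig 4 G → ℝ, Measurable X → IsZdGaugeInvariant X → (∀ U, 0 ≤ X U) →
      ∫ U, X U ∂((boxState ρ β H)[|coldGoodSetG ρ H β ε]) =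
        ∫ t, X (cfgTE ρ H β t) ∂(((gaussD H (dimE ρ))[|(goodTE ρ H β ε ∩ {t | ∀ e, ‖unscaleTE H (dimE ρ) β t e‖ ≤ m})]).tilted
          ((goodTE ρ H β ε ∩ {t | ∀ e, ‖unscaleTE H (dimE ρ) β t e‖ ≤ m}).indicator (tiltWE ρ H g β))))
    (hcond : |((∫ U, plaqCostAt ρ P.1 P.2.1.1 P.2.1.2 U * plaqCostAt ρ Q.1 Q.2.1.1 Q.2.1.2 U ∂(boxState ρ β H)) -
          (∫ U, plaqCostAt ρ P.1 P.2.1.1 P.2.1.2 U ∂(boxState ρ β H)) *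
            (∫ U, plaqCostAt ρ Q.1 Q.2.1.1 Q.2.1.2 U ∂(boxState ρ β H))) -
        ((∫ U, plaqCostAt ρ P.1 P.2.1.1 P.2.1.2 U * plaqCostAt ρ Q.1 Q.2.1.1 Q.2.1.2 U
            ∂((boxState ρ β H)[|coldGoodSetG ρ H β ε])) -
          (∫ U, plaqCostAt ρ P.1 P.2.1.1 P.2.1.2 U ∂((boxState ρ β H)[|coldGoodSetG ρ H β ε])) *
          (∫ U, plaqCostAt ρ Q.1 Q.2.1.1 Q.2.1.2 U ∂((boxState ρ β H)[|coldGoodSetG ρ H β ε])))| ≤ c₀) :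
    |β ^ 2 * ((∫ U, plaqCostAt ρ P.1 P.2.1.1 P.2.1.2 U * plaqCostAt ρ Q.1 Q.2.1.1 Q.2.1.2 U ∂(boxState ρ β H)) -
          (∫ U, plaqCostAt ρ P.1 P.2.1.1 P.2.1.2 U ∂(boxState ρ β H)) *
            (∫ U, plaqCostAt ρ Q.1 Q.2.1.1 Q.2.1.2 U ∂(boxState ρ β H))) -
        (dimE ρ : ℝ) / 4 * ((∫ s, dirCirc H (P.1, P.2.1.1, P.2.1.2) s ^ 2 * dirCirc H (Q.1, Q.2.1.1, Q.2.1.2) s ^ 2 ∂(boxDirichlet H)) -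
          (∫ s, dirCirc H (P.1, P.2.1.1, P.2.1.2) s ^ 2 ∂(boxDirichlet H)) *
            (∫ s, dirCirc H (Q.1, Q.2.1.1, Q.2.1.2) s ^ 2 ∂(boxDirichlet H)))| ≤
      β ^ 2 * c₀ + 3 * (β ^ (2 * ε)) ^ 2 * (Real.exp (2 * ((#(plaquettesTouching (boxEdges 4 (2 * H + 1))) : ℝ) * (190 * β * m ^ 3) +
          (Fintype.card (ColdFreeIdx H) : ℝ) * ℓ)) - 1) +
        6 * (β ^ (2 * ε)) ^ 2 * p + 2 * (190 * β * m ^ 3) * (β ^ (2 * ε) + dimE ρ) +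
        Real.sqrt p * (2 * β ^ (2 * ε) * dimE ρ + 3 * (dimE ρ : ℝ) ^ 2 + (dimE ρ : ℝ) ^ 2) := by
  have hβ0 : 0 < β := by linarith
  -- abbreviations
  set μ := boxState ρ β H with hμ
  set Gd := coldGoodSetG ρ H β ε with hGd
  set γ := gaussD H (dimE ρ) with hγ
  set S : Set (TSpaceD H (dimE ρ)) := goodTE ρ H β ε ∩ {t | ∀ e, ‖unscaleTE H (dimE ρ) β t e‖ ≤ m} with hS
  set x₁ : Site 4 := P.1 with hx₁
  set i₁ : Fin 4 := P.2.1.1 with hi₁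
  set j₁ : Fin 4 := P.2.1.2 with hj₁
  set x₂ : Site 4 := Q.1 with hx₂
  set i₂ : Fin 4 := Q.2.1.1 with hi₂
  set j₂ : Fin 4 := Q.2.1.2 with hj₂
  set f : LGConfig 4 G → ℝ := fun U => β * plaqCostAt ρ x₁ i₁ j₁ U with hf
  set g₂ : LGConfig 4 G → ℝ := fun U => β * plaqCostAt ρ x₂ i₂ j₂ U with hg₂
  set F : TSpaceD H (dimE ρ) → ℝ := fun t => β * plaqCostAt ρ x₁ i₁ j₁ (cfgTE ρ H β t) with hF
  set Gt : TSpaceD H (dimE ρ) → ℝ := fun t => β * plaqCostAt ρ x₂ i₂ j₂ (cfgTE ρ H β t) with hGt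
  set Q₁ : TSpaceD H (dimE ρ) → ℝ := qObsD H (dimE ρ) (x₁, i₁, j₁) with hQ₁
  set Q₂ : TSpaceD H (dimE ρ) → ℝ := qObsD H (dimE ρ) (x₂, i₂, j₂) with hQ₂
  set τ : ℝ := 190 * β * m ^ 3 with hτ
  set w : ℝ := (#(plaquettesTouching (boxEdges 4 (2 * H + 1))) : ℝ) * τ + (Fintype.card (ColdFreeIdx H) : ℝ) * ℓ with hw
  set M : ℝ := β ^ (2 * ε) with hM
  set ν := (γ[|S]).tilted (S.indicator (tiltWE ρ H g β)) with hν
  have hτ0 : 0 ≤ τ := by positivity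
  have hM0 : 0 ≤ M := by positivity
  have hD0 : (0 : ℝ) ≤ (dimE ρ : ℝ) := Nat.cast_nonneg _
  have hSm : MeasurableSet S := (measurableSet_goodTE ρ hρ hinj β ε).inter (measurableSet_ball_unscaleTE (dimE ρ) β m)
  -- the Gaussian mass of the bad event, and `γ S ≠ 0`
  have hpS : γ.real Sᶜ ≤ p := (gaussD_real_compl_goodTE_inter_ball_le ρ hρ hβ0 hH hR hmE hmEm hwin).trans hp
  have hS0 : γ S ≠ 0 := by
    intro h0
    have h1 : γ.real S = 0 := by rw [measureReal_def, h0, ENNReal.toReal_zero]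
    have h2 : γ.real S + γ.real Sᶜ = 1 := by rw [measureReal_add_measureReal_compl hSm, probReal_univ]
    linarith
  -- step 1: the conditional covariance is the covariance under the tilted conditioned Gaussian
  have hmeas : ∀ (x : Site 4) (i j : Fin 4), Measurable fun U : LGConfig 4 G => β * plaqCostAt ρ x i j U := fun x i j =>
    (measurable_plaqCostAt_of_continuous ρ hρ x i j).const_mul β
  have hnn : ∀ (x : Site 4) (i j : Fin 4) (U : LGConfig 4 G), 0 ≤ β * plaqCostAt ρ x i j U := fun x i j U => by
    refine mul_nonneg hβ0.le ?_
    simp only [plaqCostAt, plaquetteObs]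
    rw [Literature.MathematicalPhysics.QuantumFieldTheory.sub_re_trace_eq_half_norm_sub_one_sq (hρu _)]
    positivity
  have hrepF : ∫ U, f U ∂(μ[|Gd]) = ∫ t, F t ∂ν :=
    hrep _ (hmeas x₁ i₁ j₁) (isZdGaugeInvariant_const_mul_plaqCostAtG ρ β x₁ i₁ j₁) (hnn x₁ i₁ j₁)
  have hrepG : ∫ U, g₂ U ∂(μ[|Gd]) = ∫ t, Gt t ∂ν :=
    hrep _ (hmeas x₂ i₂ j₂) (isZdGaugeInvariant_const_mul_plaqCostAtG ρ β x₂ i₂ j₂) (hnn x₂ i₂ j₂)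
  have hrepFG : ∫ U, f U * g₂ U ∂(μ[|Gd]) = ∫ t, F t * Gt t ∂ν :=
    hrep _ ((hmeas x₁ i₁ j₁).mul (hmeas x₂ i₂ j₂)) (isZdGaugeInvariant_const_mul_plaqCostAt_mulG ρ β x₁ x₂ i₁ j₁ i₂ j₂)
      (fun U => mul_nonneg (hnn x₁ i₁ j₁ U) (hnn x₂ i₂ j₂ U))
  -- step 2: the bookkeeping (Dirichlet variances `≤ 1` at plaquettes touching the box)
  have hvP : ∫ s, dirCirc H (x₁, i₁, j₁) s ^ 2 ∂(boxDirichlet H) ≤ 1 := integral_dirCirc_sq_le_one_of_touching hP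
  have hvQ : ∫ s, dirCirc H (x₂, i₂, j₂) s ^ 2 ∂(boxDirichlet H) ≤ 1 := integral_dirCirc_sq_le_one_of_touching hQ
  obtain ⟨hQ₁L2, hQ₁K⟩ := memLp_two_qObsD (H := H) (D := dimE ρ) _ hvP
  obtain ⟨hQ₂L2, hQ₂K⟩ := memLp_two_qObsD (H := H) (D := dimE ρ) _ hvQ
  obtain ⟨hQ₁₂L2, hQ₁₂K⟩ := memLp_two_qObsD_mul_qObsD (H := H) (D := dimE ρ) _ _ hvP hvQ
  have hWb : ∀ t, |S.indicator (tiltWE ρ H g β) t| ≤ w := by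
    intro t
    by_cases ht : t ∈ S
    · rw [Set.indicator_of_mem ht]
      have h := abs_tiltWE_le ρ hρ hβ0 hm0 hm4 hg t ht.2
      exact h
    · rw [Set.indicator_of_notMem ht, abs_zero, hw]; positivity
  have hFb : ∀ t ∈ S, 0 ≤ F t ∧ F t ≤ M := fun t ht => by
    have h := beta_mul_plaqCostAt_mem_Icc_of_mem_goodTE ρ hρu hβ ht.1 hP
    exact h
  have hGb : ∀ t ∈ S, 0 ≤ Gt t ∧ Gt t ≤ M := fun t ht => by
    have h := beta_mul_plaqCostAt_mem_Icc_of_mem_goodTE ρ hρu hβ ht.1 hQ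
    exact h
  have hFQ : ∀ t ∈ S, |F t - Q₁ t| ≤ τ := fun t ht => by
    have h := abs_qObsD_sub_beta_mul_plaqCostAt_le ρ hρ hβ0 hm0 hm4 t ht.2 x₁ i₁ j₁
    rw [abs_sub_comm] at h
    exact h
  have hGQ : ∀ t ∈ S, |Gt t - Q₂ t| ≤ τ := fun t ht => by
    have h := abs_qObsD_sub_beta_mul_plaqCostAt_le ρ hρ hβ0 hm0 hm4 t ht.2 x₂ i₂ j₂
    rw [abs_sub_comm] at h
    exact h
  have hK'sq : ∫ t, (Q₁ t * Q₂ t) ^ 2 ∂γ ≤ (3 * (dimE ρ : ℝ) ^ 2) ^ 2 := hQ₁₂K.trans (by nlinarith [pow_nonneg hD0 4])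
  have hbook := abs_cov_tilted_cond_sub_cov_le (γ := γ) hSm hS0 (measurable_tiltWE ρ hρ hinj hgm β) hWb
    ((hmeas x₁ i₁ j₁).comp (measurable_cfgTE ρ hρ hinj β)) ((hmeas x₂ i₂ j₂).comp (measurable_cfgTE ρ hρ hinj β))
    hQ₁L2 hQ₂L2 hQ₁₂L2 hM0 hτ0 hD0 (by positivity : (0 : ℝ) ≤ 3 * (dimE ρ : ℝ) ^ 2) hFb hGb hFQ hGQ hpS
    (hQ₁K.trans (le_of_eq (by ring))) (hQ₂K.trans (le_of_eq (by ring))) hK'sq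
  -- step 3: the colour identity (general plaquettes)
  have hcol : (∫ t, Q₁ t * Q₂ t ∂γ) - (∫ t, Q₁ t ∂γ) * (∫ t, Q₂ t ∂γ) =
      (dimE ρ : ℝ) / 4 * ((∫ s, dirCirc H (x₁, i₁, j₁) s ^ 2 * dirCirc H (x₂, i₂, j₂) s ^ 2 ∂(boxDirichlet H)) -
        (∫ s, dirCirc H (x₁, i₁, j₁) s ^ 2 ∂(boxDirichlet H)) * (∫ s, dirCirc H (x₂, i₂, j₂) s ^ 2 ∂(boxDirichlet H))) :=
    cov_qObsD_gaussD_eq_general _ _ hvP hvQ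
  -- assemble
  have hcov : β ^ 2 * ((∫ U, plaqCostAt ρ x₁ i₁ j₁ U * plaqCostAt ρ x₂ i₂ j₂ U ∂μ) -
          (∫ U, plaqCostAt ρ x₁ i₁ j₁ U ∂μ) * (∫ U, plaqCostAt ρ x₂ i₂ j₂ U ∂μ)) -
        (dimE ρ : ℝ) / 4 * ((∫ s, dirCirc H (x₁, i₁, j₁) s ^ 2 * dirCirc H (x₂, i₂, j₂) s ^ 2 ∂(boxDirichlet H)) -
          (∫ s, dirCirc H (x₁, i₁, j₁) s ^ 2 ∂(boxDirichlet H)) * (∫ s, dirCirc H (x₂, i₂, j₂) s ^ 2 ∂(boxDirichlet H))) =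
      β ^ 2 * (((∫ U, plaqCostAt ρ x₁ i₁ j₁ U * plaqCostAt ρ x₂ i₂ j₂ U ∂μ) -
          (∫ U, plaqCostAt ρ x₁ i₁ j₁ U ∂μ) * (∫ U, plaqCostAt ρ x₂ i₂ j₂ U ∂μ)) -
        ((∫ U, plaqCostAt ρ x₁ i₁ j₁ U * plaqCostAt ρ x₂ i₂ j₂ U ∂(μ[|Gd])) -
          (∫ U, plaqCostAt ρ x₁ i₁ j₁ U ∂(μ[|Gd])) * (∫ U, plaqCostAt ρ x₂ i₂ j₂ U ∂(μ[|Gd])))) +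
      ((((∫ t, F t * Gt t ∂ν) - (∫ t, F t ∂ν) * (∫ t, Gt t ∂ν)) -
          ((∫ t, Q₁ t * Q₂ t ∂γ) - (∫ t, Q₁ t ∂γ) * (∫ t, Q₂ t ∂γ)))) := by
    rw [hcol, ← hrepF, ← hrepG, ← hrepFG, ← sq_mul_cov_eq]
    ring
  have h1 : |β ^ 2 * (((∫ U, plaqCostAt ρ x₁ i₁ j₁ U * plaqCostAt ρ x₂ i₂ j₂ U ∂μ) -
          (∫ U, plaqCostAt ρ x₁ i₁ j₁ U ∂μ) * (∫ U, plaqCostAt ρ x₂ i₂ j₂ U ∂μ)) -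
        ((∫ U, plaqCostAt ρ x₁ i₁ j₁ U * plaqCostAt ρ x₂ i₂ j₂ U ∂(μ[|Gd])) -
          (∫ U, plaqCostAt ρ x₁ i₁ j₁ U ∂(μ[|Gd])) * (∫ U, plaqCostAt ρ x₂ i₂ j₂ U ∂(μ[|Gd]))))| ≤ β ^ 2 * c₀ := by
    rw [abs_mul, abs_of_nonneg (by positivity : (0 : ℝ) ≤ β ^ 2)]
    exact mul_le_mul_of_nonneg_left hcond (by positivity)
  rw [hcov]
  refine (abs_add_le _ _).trans ((add_le_add h1 hbook).trans (le_of_eq ?_))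
  ring

/-! ## Bookkeeping for the six-plane corner density -/

/-- Abstract bookkeeping: if every entry of a finite square array is `≥ −e`, the double sum is at least any single entry minus
`(card² − 1)·e`. -/
theorem sum_sum_ge_single_sub {ι : Type*} [Fintype ι] (X : ι → ι → ℝ) {e : ℝ}
    (hX : ∀ a b, -e ≤ X a b) (a₀ b₀ : ι) :
    X a₀ b₀ - ((Fintype.card ι : ℝ) ^ 2 - 1) * e ≤ ∑ a, ∑ b, X a b := by
  classical
  have hnn : ∀ ab ∈ (Finset.univ : Finset ι) ×ˢ (Finset.univ : Finset ι), 0 ≤ X ab.1 ab.2 + e := fun ab _ => by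
    have := hX ab.1 ab.2; linarith
  have hsingle : X a₀ b₀ + e ≤ ∑ ab ∈ (Finset.univ : Finset ι) ×ˢ (Finset.univ : Finset ι), (X ab.1 ab.2 + e) :=
    Finset.single_le_sum hnn (a := (a₀, b₀)) (Finset.mem_product.2 ⟨Finset.mem_univ a₀, Finset.mem_univ b₀⟩)
  have hsplit : ∑ ab ∈ (Finset.univ : Finset ι) ×ˢ (Finset.univ : Finset ι), (X ab.1 ab.2 + e) =
      (∑ a, ∑ b, X a b) + (Fintype.card ι : ℝ) ^ 2 * e := by
    rw [Finset.sum_add_distrib, Finset.sum_product, Finset.sum_const, Finset.card_product, Finset.card_univ, nsmul_eq_mul]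
    push_cast; ring
  linarith

omit [CompactSpace G] in
/-- Bookkeeping at fixed `β`: if each of the 36 plane-pair covariances of the plaquette costs at two sites `x, y` is `≥ −e` after
multiplication by `β²`, then `β²` times the covariance of the two six-plane cost sums is at least the `(1,2)/(1,2)` term minus `35 e`. -/
theorem sq_mul_cov_planeSum_ge {μ : Measure (LGConfig 4 G)} [IsFiniteMeasure μ] (hρc : Continuous ρ)
    (hρu : ∀ g, ρ g ∈ Matrix.unitaryGroup (Fin N) ℂ) (x y : Site 4) {β e : ℝ}
    (hpair : ∀ q q' : {q : Fin 4 × Fin 4 // q.1 < q.2},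
      -e ≤ β ^ 2 * ((∫ U, plaqCostAt ρ x q.1.1 q.1.2 U * plaqCostAt ρ y q'.1.1 q'.1.2 U ∂μ) -
        (∫ U, plaqCostAt ρ x q.1.1 q.1.2 U ∂μ) * (∫ U, plaqCostAt ρ y q'.1.1 q'.1.2 U ∂μ))) :
    β ^ 2 * ((∫ U, plaqCostAt ρ x 1 2 U * plaqCostAt ρ y 1 2 U ∂μ) -
        (∫ U, plaqCostAt ρ x 1 2 U ∂μ) * (∫ U, plaqCostAt ρ y 1 2 U ∂μ)) - 35 * e ≤
      β ^ 2 * ((∫ U, (∑ q : {q : Fin 4 × Fin 4 // q.1 < q.2}, plaqCostAt ρ x q.1.1 q.1.2 U) *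
            (∑ q : {q : Fin 4 × Fin 4 // q.1 < q.2}, plaqCostAt ρ y q.1.1 q.1.2 U) ∂μ) -
        (∫ U, ∑ q : {q : Fin 4 × Fin 4 // q.1 < q.2}, plaqCostAt ρ x q.1.1 q.1.2 U ∂μ) *
          (∫ U, ∑ q : {q : Fin 4 × Fin 4 // q.1 < q.2}, plaqCostAt ρ y q.1.1 q.1.2 U ∂μ)) := by
  have hcov := cov_sum_sum_eq μ (fun q : {q : Fin 4 × Fin 4 // q.1 < q.2} => plaqCostAt ρ x q.1.1 q.1.2)
    (fun q : {q : Fin 4 × Fin 4 // q.1 < q.2} => plaqCostAt ρ y q.1.1 q.1.2)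
    (fun q => integrable_plaqCostAt_of_rep ρ hρc hρu x q.1.1 q.1.2 μ) (fun q => integrable_plaqCostAt_of_rep ρ hρc hρu y q.1.1 q.1.2 μ)
    (fun q q' => integrable_plaqCostAt_mul_of_rep' ρ hρc hρu x y q.1.1 q.1.2 q'.1.1 q'.1.2 μ)
  have hmain := sum_sum_ge_single_sub
    (fun q q' : {q : Fin 4 × Fin 4 // q.1 < q.2} =>
      β ^ 2 * ((∫ U, plaqCostAt ρ x q.1.1 q.1.2 U * plaqCostAt ρ y q'.1.1 q'.1.2 U ∂μ) -
        (∫ U, plaqCostAt ρ x q.1.1 q.1.2 U ∂μ) * (∫ U, plaqCostAt ρ y q'.1.1 q'.1.2 U ∂μ)))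
    hpair ⟨((1 : Fin 4), (2 : Fin 4)), by decide⟩ ⟨((1 : Fin 4), (2 : Fin 4)), by decide⟩
  -- six planes `μ < ν` in four dimensions (the tree's `CurvatureBoostCovariance.Negative.card_planes`, not imported to keep the
  -- BOX engine's import cone clean)
  have hcard : Fintype.card {q : Fin 4 × Fin 4 // q.1 < q.2} = 6 := by decide
  rw [hcard] at hmain
  rw [hcov, Finset.mul_sum]
  simp_rw [Finset.mul_sum]
  norm_num at hmain
  linarith [hmain]

end Summit.QuantumFields.YangMills.Theorems.ColdBoxAllGroups

end
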